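import Summits.RiemannHypothesis.RiemannHypothesis.Theorems.LiAsymptoticSmoothReplace
import Summits.RiemannHypothesis.RiemannHypothesis.Theorems.LiAsymptoticModelIntegral
import Literature.NumberTheory.LFunctions.MeanSquareNearPeak
import Literature.NumberTheory.LFunctions.VinogradovKorobovFarZerosWindow
import HarnessLib

/-!
# RiemannHypothesis / LiDirichletAsymptotic — crux K2χ `LiSmoothMainTermChar`, helper: the CONDUCTOR CHANNEL (RH-FREE · GRH-FREE)

RH-FREE · GRH-FREE PROOF-OF-DATA (rung L-P(P1⁺χ)) [rh-li-prover].  Route `Theses/LiDirichletAsymptotic.lean`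
(cell `pub/rh-li`, round 5 (iii)), helper for item `LiSmoothMainTermChar` (stmt-RiemannHypothesis-19630).
In the χ-twin of the smooth main term the density `g_χ = ϑ' + ½ log q + δ_a` carries the conductor only through
the constant `½ log q`, so the new integral to control is the plain window mass

  `∫_{√n}^{T'} f_n(t) dt = nπ/2 − √n ± 61/24`   (`n ≥ 1`, `T' ≥ n²`, `f_n = liWindowWeight n`; `abs_conductor_channel`):

`f_n` is replaced by the model `1 − cos(n/t)` (`|f_n − (1 − cos(n/t))| ≤ n/(12t³)`, tree `SmoothReplace`), the
substitution `u = n/t` turns `∫_{√n}^{T'} (1 − cos(n/t)) dt` into `n ∫_{n/T'}^{√n} (1 − cos u)/u² du`, the full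
integral is `∫_0^∞ (1 − cos u)/u² = π/2` (tree `ModelIntegral.integral_one_sub_cos_div_sq`), the low piece is
`≤ n²/(2T') ≤ ½` and the tail is `1/√n ± 2/n` by one integration by parts (`∫ cos u/u² = [sin u/u²] + 2∫ sin u/u³`,
then `B → ∞`).  Nothing here bears on the truth of RH or GRH.
-/

noncomputable section

-- D-0017: `Summit.<S>.<S>.…` is the designed namespace of a single-problem summit.
set_option linter.dupNamespace false

open MeasureTheory intervalIntegral Set Filter
open scoped Topology

namespace Summit.RiemannHypothesis.RiemannHypothesis.Theorems.LiTheory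

open Literature.NumberTheory.LFunctions

namespace SmoothChar
/-! ### The model weight `1 − cos(n/t)` in the variable `u = n/t`: change of variables, low piece and tail -/

/-- `d/du (1/u²) = −2/u³` off `0`. -/
theorem hasDerivAt_one_div_sq {u : ℝ} (hu : u ≠ 0) :
    HasDerivAt (fun y : ℝ ↦ 1 / y ^ 2) (-2 / u ^ 3) u := by
  have h := ((hasDerivAt_pow 2 u).inv (pow_ne_zero 2 hu)).const_mul (1 : ℝ)
  have e1 : (fun y : ℝ ↦ 1 / y ^ 2) = fun y : ℝ ↦ (1 : ℝ) * (y ^ 2)⁻¹ := by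
    funext y; rw [one_mul, one_div]
  rw [e1]
  refine h.congr_deriv ?_
  push_cast
  field_simp


/-- **Substitution `u = n/t`:** `∫_a^b (1 − cos(n/t)) dt = n ∫_{n/b}^{n/a} (1 − cos u)/u² du` (`0 < a ≤ b`, `n ≥ 1`). -/
theorem integral_model_cov (n : ℕ) (hn : 1 ≤ n) {a b : ℝ} (ha : 0 < a) (hab : a ≤ b) :
    ∫ t in a..b, (1 - Real.cos (n / t)) =
      n * ∫ u in (n : ℝ) / b..(n : ℝ) / a, (1 - Real.cos u) / u ^ 2 := by
  have hn0 : (0 : ℝ) < n := by exact_mod_cast hn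
  have hne : ∀ t ∈ uIcc a b, t ≠ 0 := fun t ht ↦ by
    rw [uIcc_of_le hab] at ht; exact (lt_of_lt_of_le ha ht.1).ne'
  have hd : ∀ t ∈ uIcc a b, HasDerivAt (fun s : ℝ ↦ (n : ℝ) / s) (-(n : ℝ) / t ^ 2) t := fun t ht ↦ by
    have h := (hasDerivAt_inv (hne t ht)).const_mul (n : ℝ)
    have e1 : (fun s : ℝ ↦ (n : ℝ) / s) = fun s : ℝ ↦ (n : ℝ) * s⁻¹ := by
      funext s; rw [div_eq_mul_inv]
    rw [e1]
    refine h.congr_deriv ?_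
    have := hne t ht
    field_simp
  have hc : ContinuousOn (fun t : ℝ ↦ -(n : ℝ) / t ^ 2) (uIcc a b) := by
    refine continuousOn_of_forall_continuousAt fun t ht ↦ ?_
    have : t ^ 2 ≠ 0 := pow_ne_zero 2 (hne t ht)
    fun_prop (disch := assumption)
  have hFc : ContinuousOn (fun u : ℝ ↦ (1 - Real.cos u) / u ^ 2) ((fun s : ℝ ↦ (n : ℝ) / s) '' uIcc a b) := by
    have h1 : ContinuousOn (fun u : ℝ ↦ (1 - Real.cos u) / u ^ 2) {u : ℝ | u ≠ 0} := by
      refine continuousOn_of_forall_continuousAt fun u hu ↦ ?_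
      have : u ^ 2 ≠ 0 := pow_ne_zero 2 hu
      fun_prop (disch := assumption)
    refine h1.mono ?_
    rintro _ ⟨t, ht, rfl⟩
    exact div_ne_zero hn0.ne' (hne t ht)
  have key := intervalIntegral.integral_comp_mul_deriv' hd hc hFc
  have e : EqOn (fun t ↦ ((fun u : ℝ ↦ (1 - Real.cos u) / u ^ 2) ∘ (fun s : ℝ ↦ (n : ℝ) / s)) t * (-(n : ℝ) / t ^ 2))
      (fun t ↦ -(1 / n) * (1 - Real.cos (n / t))) (uIcc a b) := by
    intro t ht
    have ht0 := hne t ht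
    simp only [Function.comp]
    field_simp
  rw [intervalIntegral.integral_congr e, intervalIntegral.integral_const_mul] at key
  rw [intervalIntegral.integral_symm ((n : ℝ) / a) ((n : ℝ) / b), ← key]
  field_simp

/-- The low piece: `0 ≤ ∫_0^c (1 − cos u)/u² ≤ c/2` (`1 − cos u ≤ u²/2`). -/
theorem model_low_bounds {c : ℝ} (hc : 0 ≤ c) :
    0 ≤ ∫ u in (0 : ℝ)..c, (1 - Real.cos u) / u ^ 2 ∧
      ∫ u in (0 : ℝ)..c, (1 - Real.cos u) / u ^ 2 ≤ c / 2 := by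
  have hF0 : ∀ u : ℝ, 0 ≤ (1 - Real.cos u) / u ^ 2 := fun u ↦
    div_nonneg (by linarith [Real.cos_le_one u]) (sq_nonneg u)
  have hF1 : ∀ u : ℝ, (1 - Real.cos u) / u ^ 2 ≤ 1 / 2 := fun u ↦ by
    rcases eq_or_ne u 0 with h | h
    · subst h; norm_num
    · rw [div_le_iff₀ (by positivity)]
      linarith [Real.one_sub_sq_div_two_le_cos (x := u)]
  refine ⟨intervalIntegral.integral_nonneg hc fun u _ ↦ hF0 u, ?_⟩
  have h := intervalIntegral.norm_integral_le_of_norm_le_const (a := 0) (b := c) (C := 1 / 2)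
    (f := fun u : ℝ ↦ (1 - Real.cos u) / u ^ 2) (fun u _ ↦ by
      rw [Real.norm_eq_abs, abs_of_nonneg (hF0 u)]; exact hF1 u)
  rw [Real.norm_eq_abs, sub_zero, abs_of_nonneg hc] at h
  have := le_of_abs_le h
  linarith

/-- **The tail by one integration by parts:** `|∫_{(A,∞)} (1 − cos u)/u² du − 1/A| ≤ 2/A²` for `A > 0`
(`∫_A^B cos u/u² = [sin u/u²]_A^B + 2∫_A^B sin u/u³`, then `B → ∞`). -/
theorem abs_integral_model_tail {A : ℝ} (hA : 0 < A) :
    |(∫ u in Ioi A, (1 - Real.cos u) / u ^ 2) - 1 / A| ≤ 2 / A ^ 2 := by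
  have hfin : ∀ B : ℝ, A ≤ B →
      |(∫ u in A..B, (1 - Real.cos u) / u ^ 2) - 1 / A| ≤ 2 / A ^ 2 + 1 / B := by
    intro B hAB
    have hB : 0 < B := lt_of_lt_of_le hA hAB
    have hne : ∀ u ∈ uIcc A B, u ≠ 0 := fun u hu ↦ by
      rw [uIcc_of_le hAB] at hu; exact (lt_of_lt_of_le hA hu.1).ne'
    have hi1 : IntervalIntegrable (fun u : ℝ ↦ 1 / u ^ 2) volume A B :=
      intervalIntegral.intervalIntegrable_one_div (fun u hu ↦ pow_ne_zero 2 (hne u hu)) (by fun_prop)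
    have hi2 : IntervalIntegrable (fun u : ℝ ↦ Real.cos u / u ^ 2) volume A B := by
      refine ContinuousOn.intervalIntegrable (continuousOn_of_forall_continuousAt fun u hu ↦ ?_)
      have : u ^ 2 ≠ 0 := pow_ne_zero 2 (hne u hu)
      fun_prop (disch := assumption)
    have hsplit : ∫ u in A..B, (1 - Real.cos u) / u ^ 2 =
        (∫ u in A..B, 1 / u ^ 2) - ∫ u in A..B, Real.cos u / u ^ 2 := by
      rw [← intervalIntegral.integral_sub hi1 hi2]
      exact intervalIntegral.integral_congr fun u _ ↦ by simp only [sub_div]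
    -- integration by parts for `∫ cos u · (1/u²)`
    have hu : ∀ u ∈ uIcc A B, HasDerivAt (fun y : ℝ ↦ 1 / y ^ 2) (-2 / u ^ 3) u :=
      fun u hu ↦ hasDerivAt_one_div_sq (hne u hu)
    have hv : ∀ u ∈ uIcc A B, HasDerivAt Real.sin (Real.cos u) u := fun u _ ↦ Real.hasDerivAt_sin u
    have hu' : IntervalIntegrable (fun u : ℝ ↦ -2 / u ^ 3) volume A B := by
      refine ContinuousOn.intervalIntegrable (continuousOn_of_forall_continuousAt fun u hu ↦ ?_)
      have : u ^ 3 ≠ 0 := pow_ne_zero 3 (hne u hu)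
      fun_prop (disch := assumption)
    have hv' : IntervalIntegrable (fun u : ℝ ↦ Real.cos u) volume A B :=
      Real.continuous_cos.continuousOn.intervalIntegrable
    have hparts := intervalIntegral.integral_mul_deriv_eq_deriv_mul hu hv hu' hv'
    have hcos : ∫ u in A..B, Real.cos u / u ^ 2 =
        1 / B ^ 2 * Real.sin B - 1 / A ^ 2 * Real.sin A + ∫ u in A..B, 2 / u ^ 3 * Real.sin u := by
      have e1 : ∫ u in A..B, Real.cos u / u ^ 2 = ∫ u in A..B, 1 / u ^ 2 * Real.cos u :=
        intervalIntegral.integral_congr fun u _ ↦ by ring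
      have e2 : ∫ u in A..B, 2 / u ^ 3 * Real.sin u = -∫ u in A..B, -2 / u ^ 3 * Real.sin u := by
        rw [← intervalIntegral.integral_neg]
        exact intervalIntegral.integral_congr fun u _ ↦ by ring
      rw [e1, hparts, e2]; ring
    -- the remaining integral is at most `1/A² − 1/B²`
    have hrest : |∫ u in A..B, 2 / u ^ 3 * Real.sin u| ≤ 1 / A ^ 2 - 1 / B ^ 2 := by
      rw [← FarZeros.integral_two_div_cube hA hAB, ← Real.norm_eq_abs]
      refine intervalIntegral.norm_integral_le_of_norm_le hAB (ae_of_all _ fun u hu ↦ ?_) ?_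
      · have hu0 : 0 < u := lt_of_lt_of_le hA hu.1.le
        have h3 : 0 < u ^ 3 := pow_pos hu0 3
        rw [Real.norm_eq_abs, abs_mul, abs_div, abs_of_pos h3, abs_two]
        have hs := Real.abs_sin_le_one u
        have h2 : 0 ≤ 2 / u ^ 3 := by positivity
        calc 2 / u ^ 3 * |Real.sin u| ≤ 2 / u ^ 3 * 1 := mul_le_mul_of_nonneg_left hs h2
          _ = 2 / u ^ 3 := mul_one _
      · have h : IntervalIntegrable (fun u : ℝ ↦ 1 / u ^ 3) volume A B :=
          intervalIntegral.intervalIntegrable_one_div (fun u hu ↦ pow_ne_zero 3 (hne u hu)) (by fun_prop)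
        convert h.const_mul 2 using 1
        funext u; ring
    have hsB : |1 / B ^ 2 * Real.sin B| ≤ 1 / B ^ 2 := by
      rw [abs_mul, abs_of_pos (by positivity : (0 : ℝ) < 1 / B ^ 2)]
      have := Real.abs_sin_le_one B
      have h0 : (0 : ℝ) ≤ 1 / B ^ 2 := by positivity
      nlinarith
    have hsA : |1 / A ^ 2 * Real.sin A| ≤ 1 / A ^ 2 := by
      rw [abs_mul, abs_of_pos (by positivity : (0 : ℝ) < 1 / A ^ 2)]
      have := Real.abs_sin_le_one A
      have h0 : (0 : ℝ) ≤ 1 / A ^ 2 := by positivity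
      nlinarith
    rw [hsplit, MeanSquareNearPeak.integral_inv_sq hA hAB, hcos]
    have hB1 : 0 ≤ 1 / B := by positivity
    obtain ⟨h1, h2⟩ := abs_le.1 hsB
    obtain ⟨h3, h4⟩ := abs_le.1 hsA
    obtain ⟨h5, h6⟩ := abs_le.1 hrest
    have e22 : (2 : ℝ) / A ^ 2 = 2 * (1 / A ^ 2) := by ring
    rw [abs_le]; constructor <;> linarith
  -- pass to the limit `B → ∞`
  have hfi : IntegrableOn (fun u : ℝ ↦ (1 - Real.cos u) / u ^ 2) (Ioi A) :=
    ModelIntegral.integrableOn_one_sub_cos_div_sq.mono_set (Ioi_subset_Ioi hA.le)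
  have hlim := ((intervalIntegral_tendsto_integral_Ioi A hfi tendsto_id).sub_const (1 / A)).abs
  have hlim2 : Tendsto (fun B : ℝ ↦ 2 / A ^ 2 + 1 / B) atTop (𝓝 (2 / A ^ 2)) := by
    have h0 : Tendsto (fun B : ℝ ↦ 1 / B) atTop (𝓝 0) := tendsto_const_nhds.div_atTop tendsto_id
    simpa using tendsto_const_nhds.add h0
  exact le_of_tendsto_of_tendsto hlim hlim2 ((eventually_ge_atTop A).mono fun B hB ↦ hfin B hB)

/-- **The CONDUCTOR CHANNEL**: `|∫_{√n}^{T'} f_n(t) dt − (nπ/2 − √n)| ≤ 61/24` for `n ≥ 1`, `T' ≥ n²`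
(`∫_0^∞ (1 − cos u)/u² = π/2`, low piece `≤ n²/(2T') ≤ ½`, tail `≤ 2n/(√n)² = 2`, window vs model `≤ 1/24`). -/
theorem abs_conductor_channel (n : ℕ) (T' : ℝ) (hn : 1 ≤ n) (hT' : (n : ℝ) ^ 2 ≤ T') :
    |(∫ t in Real.sqrt n..T', liWindowWeight n t) - (n * Real.pi / 2 - Real.sqrt n)| ≤ 61 / 24 := by
  have hnR : (1 : ℝ) ≤ n := by exact_mod_cast hn
  have hn0 : (0 : ℝ) < n := by linarith
  set a := Real.sqrt n with ha
  have haa : a ^ 2 = n := by rw [ha, Real.sq_sqrt hn0.le]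
  have ha1 : 1 ≤ a := by
    rw [ha, ← Real.sqrt_one]; exact Real.sqrt_le_sqrt hnR
  have ha0 : 0 < a := by linarith
  have hna : (n : ℝ) / a = a := by rw [ha, Real.div_sqrt]
  have hnn : (n : ℝ) ≤ (n : ℝ) ^ 2 := by nlinarith
  have haT : a ≤ T' := by nlinarith
  have hT0 : 0 < T' := by linarith
  have hne : ∀ t ∈ uIcc a T', t ≠ 0 := fun t ht ↦ by
    rw [uIcc_of_le haT] at ht; exact (lt_of_lt_of_le ha0 ht.1).ne'
  -- (1) replace `f_n` by the model `1 − cos(n/t)`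
  have hi_f : IntervalIntegrable (liWindowWeight n) volume a T' :=
    (SmoothReplace.continuousOn_liWindowWeight n hne).intervalIntegrable
  have hi_m : IntervalIntegrable (fun t : ℝ ↦ 1 - Real.cos (n / t)) volume a T' := by
    refine ContinuousOn.intervalIntegrable (continuousOn_of_forall_continuousAt fun t ht ↦ ?_)
    have : t ≠ 0 := hne t ht
    fun_prop (disch := assumption)
  have hrepl : |(∫ t in a..T', liWindowWeight n t) - ∫ t in a..T', (1 - Real.cos (n / t))| ≤ 1 / 24 := by
    rw [← intervalIntegral.integral_sub hi_f hi_m, ← Real.norm_eq_abs]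
    have hg : IntervalIntegrable (fun t : ℝ ↦ (n : ℝ) / 24 * (2 / t ^ 3)) volume a T' := by
      refine ContinuousOn.intervalIntegrable (continuousOn_of_forall_continuousAt fun t ht ↦ ?_)
      have : t ^ 3 ≠ 0 := pow_ne_zero 3 (hne t ht)
      fun_prop (disch := assumption)
    refine (intervalIntegral.norm_integral_le_of_norm_le haT (ae_of_all _ fun t ht ↦ ?_) hg).trans ?_
    · have ht0 : 0 < t := lt_of_lt_of_le ha0 ht.1.le
      rw [Real.norm_eq_abs]
      refine (SmoothReplace.abs_liWindowWeight_sub_model_le n ht0).trans (le_of_eq ?_)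
      field_simp
      ring
    · rw [intervalIntegral.integral_const_mul, FarZeros.integral_two_div_cube ha0 haT, haa]
      have h1 : 0 ≤ (n : ℝ) / 24 * (1 / T' ^ 2) := by positivity
      have e : (n : ℝ) / 24 * (1 / n - 1 / T' ^ 2) = 1 / 24 - n / 24 * (1 / T' ^ 2) := by
        field_simp
      rw [e]
      linarith
  -- (2) the model integral: substitution, then `π/2 − low − tail`
  have hcov := integral_model_cov n hn ha0 haT
  rw [hna] at hcov
  set c := (n : ℝ) / T' with hc
  have hc0 : 0 ≤ c := by positivity
  have hc1 : (n : ℝ) * c ≤ 1 := by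
    rw [hc, ← mul_div_assoc, div_le_one hT0]; nlinarith
  have hca : c ≤ a := by
    have : c ≤ 1 := by
      have : (n : ℝ) * c ≥ c := le_mul_of_one_le_left hc0 hnR
      linarith
    linarith
  have hfi0 : IntegrableOn (fun u : ℝ ↦ (1 - Real.cos u) / u ^ 2) (Ioi 0) :=
    ModelIntegral.integrableOn_one_sub_cos_div_sq
  have hfic : IntegrableOn (fun u : ℝ ↦ (1 - Real.cos u) / u ^ 2) (Ioi c) := hfi0.mono_set (Ioi_subset_Ioi hc0)
  have hs1 := intervalIntegral.integral_Ioi_sub_Ioi hfi0 hc0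
  have hs2 := intervalIntegral.integral_Ioi_sub_Ioi hfic hca
  rw [ModelIntegral.integral_one_sub_cos_div_sq] at hs1
  obtain ⟨hlow0, hlow1⟩ := model_low_bounds hc0
  have htail := abs_integral_model_tail ha0
  set L := ∫ u in (0 : ℝ)..c, (1 - Real.cos u) / u ^ 2 with hL
  set R := ∫ u in Ioi a, (1 - Real.cos u) / u ^ 2 with hR
  have hM : ∫ u in c..a, (1 - Real.cos u) / u ^ 2 = Real.pi / 2 - L - R := by linarith
  have key : (∫ t in a..T', liWindowWeight n t) - (n * Real.pi / 2 - a) =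
      ((∫ t in a..T', liWindowWeight n t) - ∫ t in a..T', (1 - Real.cos (n / t))) -
        n * L - n * (R - 1 / a) := by
    rw [hcov, hM]
    have e : (n : ℝ) * (1 / a) = a := by rw [mul_one_div, hna]
    linear_combination (-1 : ℝ) * e
  have hL1 : (n : ℝ) * L ≤ 1 / 2 := by
    calc (n : ℝ) * L ≤ n * (c / 2) := mul_le_mul_of_nonneg_left hlow1 hn0.le
      _ ≤ 1 / 2 := by nlinarith
  have hL0 : 0 ≤ (n : ℝ) * L := mul_nonneg hn0.le hlow0
  have hR2 : |(n : ℝ) * (R - 1 / a)| ≤ 2 := by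
    rw [abs_mul, abs_of_pos hn0]
    calc (n : ℝ) * |R - 1 / a| ≤ n * (2 / a ^ 2) := mul_le_mul_of_nonneg_left htail hn0.le
      _ = 2 := by rw [haa]; field_simp
  rw [key]
  obtain ⟨h1, h2⟩ := abs_le.1 hrepl
  obtain ⟨h3, h4⟩ := abs_le.1 hR2
  rw [abs_le]; constructor <;> linarith

end SmoothChar

end Summit.RiemannHypothesis.RiemannHypothesis.Theorems.LiTheory

end
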